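import Literature.AlgebraicTopology.SingularHomology.FreeActionEulerCharacteristic
import Literature.AlgebraicTopology.SingularHomology.ModPBettiNumbers
import Literature.AlgebraicTopology.SingularHomology.BettiNumberBaseChange
import Literature.AlgebraicTopology.SingularHomology.RationalEulerCharacteristic
import Literature.AlgebraicTopology.SingularHomology.UniversalCoefficientsField
import Literature.AlgebraicTopology.SingularHomology.FundamentalClassProofs
import Literature.AlgebraicTopology.SingularHomology.CompactManifoldFiniteness
import Mathlib.RepresentationTheory.Character
import Mathlib.Topology.Covering.Quotient
import HarnessLib

/-!
# Lefschetz numbers of free periodic maps of closed manifolds vanish in the mean (Smith theory + transfer)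

For a finite group `G` acting freely on a closed topological manifold `M`, the classical route to
"`Σ_{g ∈ G} L(g) = |G| χ(M/G) = χ(M)`", i.e. the Lefschetz numbers of the non-trivial elements
sum to zero, WITHOUT the Lefschetz fixed point theorem: the Euler characteristic is multiplicative
in free `ℤ/p`-quotients (P. A. Smith / E. E. Floyd; G. E. Bredon, *Introduction to Compact
Transformation Groups* (1972), Ch. III Thm. 7.10, free case, PROVED in
`FreeActionEulerCharacteristic.lean`), and with coefficients in a field in which `|G|` is
invertible the projection identifies `H^k(M/G)` with the invariants `H^k(M)^G` (the transfer,
A. Hatcher, *Algebraic Topology* (2002), §3.G Prop. 3G.1: *"`H^k(X; F) → H^k(X̃; F)` is injective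
with image the `G`-invariants"*), whose dimension is the average of the traces (the projector
`|G|⁻¹ Σ_g g^*`; J.-P. Serre, *Linear Representations of Finite Groups*, §2.3).

This file PROVES, on the tree's singular cohomology:

* §1 (linear algebra) `card_mul_finrank_ker_eq_sum_trace_pow`: `m · dim ker(A - 1) = Σ_{j<m} tr Aʲ`
  for `Aᵐ = 1`; `finrank_ker_sub_one_eq_of_comm`: fixed vectors transported along an equivariant
  injection.
* §2 (transfer over a field with `|G|` invertible) for `c : FiniteDeckCover G E B`:
  `map_proj_injective_of_isUnit_card`, `mem_range_map_proj_iff` (image of `p^*` = invariants),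
  **`card_mul_finrank_eq_sum_trace`**: `|G| · dim H^k(B; F) = Σ_g tr(g^* | H^k(E; F))`.
* §3 closed manifolds: finiteness / vanishing of `H^k(M; F)` over any field, and
  `euler_complex_eq_euler_zmod`: `Σ_{k≤n} (-1)^k dim_ℂ H^k(M; ℂ) = Σ_{k≤n} (-1)^k dim_{𝔽ₚ} H^k(M; 𝔽ₚ)`.
* §4 the orbit space `OrbitSpace t = M/⟨t⟩` of a homeomorphism `t` of prime order `p` acting freely
  on a closed `n`-manifold: it is a closed `n`-manifold (`OrbitSpace.chartedSpace`, `t2Space`), the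
  projection is a `p`-sheeted regular covering, **`euler_eq_prime_mul_euler`** (`χ_ℂ(M) = p χ_ℂ(M/⟨t⟩)`),
  **`finrank_cohomology_orbitSpace_eq`** (`dim H^k(M/⟨t⟩; ℂ) = dim ker(t^* - 1)`), and the induced
  homeomorphism `OrbitSpace.map s` of a homeomorphism `s` commuting with `t`.
* §5 **`lefschetz_sums_of_free_zmod_six`**: for a homeomorphism `a` of a closed manifold with
  `a⁶ = 1` and `a²`, `a³` fixed-point free, the Lefschetz numbers `L(j) = Σ_k (-1)^k tr((a^*)ʲ|H^k(M; ℂ))`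
  satisfy `L(3) = 0`, `L(2) + L(4) = 0`, `L(1) + L(5) = 0` (tower `M → M/⟨a³⟩ → M/⟨a⟩` and `M → M/⟨a²⟩`).

Everything is proved; no named facts, no global instances.

## References

* [Bredon1972] G. E. Bredon, Introduction to Compact Transformation
  Groups, Academic Press 1972, Ch. III Thm. 7.10.
* [AlldayPuppe1993] C. Allday, V. Puppe, Cohomological Methods in Transformation Groups, CUP 1993,
  Remark (3.10.19)(3), p. 207.
* [HatcherAT2002] A. Hatcher, Algebraic Topology, CUP 2002, §1.3 Prop. 1.40, §3.G Prop. 3G.1.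
* [SerreLinearRepresentations1977] J.-P. Serre, Linear Representations of Finite Groups, GTM 42, §2.3.
-/

noncomputable section

open CategoryTheory Limits

universe u v w

namespace Literature.AlgebraicTopology.SingularHomology

/-! ### §1 Linear algebra: averaging over a cyclic group, transport of fixed vectors -/

section LinearAlgebra

variable {F : Type v} [Field F] {V W : Type w} [AddCommGroup V] [Module F V] [AddCommGroup W] [Module F W]

/-- Shift of the averaging sum: `Σ_{j<m} A^{j+1} = Σ_{j<m} Aʲ` when `Aᵐ = 1`. [folklore] -/
lemma sum_range_pow_succ_eq_of_pow_eq_one {A : Module.End F V} {m : ℕ} (hA : A ^ m = 1) :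
    ∑ j ∈ Finset.range m, A ^ (j + 1) = ∑ j ∈ Finset.range m, A ^ j := by
  have h := Finset.sum_range_succ (fun j => A ^ j) m
  have h' := Finset.sum_range_succ' (fun j => A ^ j) m
  rw [h', hA, pow_zero] at h
  exact add_right_cancel h

/-- **Averaging over a cyclic group** (Serre, *Linear Representations*, §2.3, the projector
`|G|⁻¹ Σ_g ρ(g)` onto the invariants, for `G = ⟨A⟩`): if `Aᵐ = 1` on a finite-dimensional space over
a field in which `m ≠ 0`, then `m · dim ker(A - 1) = Σ_{j<m} tr(Aʲ)`.
[cite: SerreLinearRepresentations1977, §2.3 (projection onto invariants)] -/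
theorem card_mul_finrank_ker_eq_sum_trace_pow [FiniteDimensional F V] (A : Module.End F V) {m : ℕ}
    (hA : A ^ m = 1) (hm : (m : F) ≠ 0) :
    (m : F) * Module.finrank F (LinearMap.ker (A - 1)) =
      ∑ j ∈ Finset.range m, LinearMap.trace F V (A ^ j) := by
  set P : Module.End F V := (m : F)⁻¹ • ∑ j ∈ Finset.range m, A ^ j with hP
  have hfix : ∀ v, A v = v → ∀ j : ℕ, (A ^ j) v = v := by
    intro v hv j
    induction j with
    | zero => rfl
    | succ j ih => rw [pow_succ, Module.End.mul_apply, hv, ih]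
  have hproj : LinearMap.IsProj (LinearMap.ker (A - 1)) P := by
    constructor
    · intro v
      rw [LinearMap.mem_ker, LinearMap.sub_apply, Module.End.one_apply, sub_eq_zero, hP,
        LinearMap.smul_apply, map_smul, LinearMap.sum_apply, map_sum]
      congr 1
      have := congrArg (fun B : Module.End F V => B v) (sum_range_pow_succ_eq_of_pow_eq_one hA)
      simp only [LinearMap.sum_apply] at this
      rw [← this]
      exact Finset.sum_congr rfl fun j _ => by rw [pow_succ', Module.End.mul_apply]
    · intro v hv
      rw [LinearMap.mem_ker, LinearMap.sub_apply, Module.End.one_apply, sub_eq_zero] at hv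
      rw [hP, LinearMap.smul_apply, LinearMap.sum_apply]
      rw [Finset.sum_congr rfl fun j _ => hfix v hv j, Finset.sum_const, Finset.card_range,
        ← Nat.cast_smul_eq_nsmul F, smul_smul, inv_mul_cancel₀ hm, one_smul]
  have htr := hproj.trace
  rw [hP, map_smul, map_sum, smul_eq_mul] at htr
  rw [← htr, ← mul_assoc, mul_inv_cancel₀ hm, one_mul]

/-- **Transport of fixed vectors along an equivariant injection**: if `q : W → V` is one-to-one,
`A ∘ q = q ∘ B`, and every `A`-fixed vector lies in the image of `q`, then
`dim ker(B - 1) = dim ker(A - 1)` (`q` restricts to an isomorphism of the fixed spaces). [folklore] -/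
theorem finrank_ker_sub_one_eq_of_comm (A : Module.End F V) (B : Module.End F W) (q : W →ₗ[F] V)
    (hq : Function.Injective q) (hcomm : A ∘ₗ q = q ∘ₗ B)
    (hfix : ∀ v, A v = v → v ∈ LinearMap.range q) :
    Module.finrank F (LinearMap.ker (B - 1)) = Module.finrank F (LinearMap.ker (A - 1)) := by
  have hmap : (LinearMap.ker (B - 1)).map q = LinearMap.ker (A - 1) := by
    ext v
    simp only [Submodule.mem_map, LinearMap.mem_ker, LinearMap.sub_apply, Module.End.one_apply,
      sub_eq_zero]
    constructor
    · rintro ⟨w, hw, rfl⟩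
      have := LinearMap.congr_fun hcomm w
      simp only [LinearMap.comp_apply] at this
      rw [this, hw]
    · intro hv
      obtain ⟨w, rfl⟩ := hfix v hv
      refine ⟨w, hq ?_, rfl⟩
      have := LinearMap.congr_fun hcomm w
      simp only [LinearMap.comp_apply] at this
      rw [← this, hv]
  rw [← hmap]
  exact (Submodule.equivMapOfInjective q hq _).finrank_eq

end LinearAlgebra

/-! ### §2 The transfer over a field in which `|G|` is invertible: `H^k(B; F) ≅ H^k(E; F)^G` -/

namespace FiniteDeckCover

variable {G : Type w} [Group G] [Fintype G] {E B : Type u} [TopologicalSpace E] [TopologicalSpace B]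
  [MulAction G E] (c : FiniteDeckCover G E B) (F : Type v) [Field F]

/-- **`p^*` is injective when `|G|` is invertible in the coefficient field** (`τ^* p^* = |G|`,
Hatcher Prop. 3G.1). [cite: HatcherAT2002, §3.G Prop. 3G.1] -/
theorem map_proj_injective_of_card_ne_zero (hG : (Fintype.card G : F) ≠ 0) (k : ℕ) :
    Function.Injective (singularCohomology.map F F c.proj k) := by
  intro x y hxy
  have hx := c.transferMap_map (R := F) k x
  have hy := c.transferMap_map (R := F) k y
  rw [hxy, hy] at hx
  rw [← Nat.cast_smul_eq_nsmul F, ← Nat.cast_smul_eq_nsmul F] at hx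
  exact smul_right_injective _ hG hx.symm

/-- `g^* ∘ p^* = p^*` (`proj ∘ g = proj`). [cite: HatcherAT2002, §1.3] -/
theorem cohomologyMap_deck_map_proj (g : G) (k : ℕ) (x : singularCohomology F F B k) :
    singularCohomology.map F F (c.deck g) k (singularCohomology.map F F c.proj k x) =
      singularCohomology.map F F c.proj k x := by
  have h : c.proj.comp (c.deck g) = c.proj := ContinuousMap.ext fun e => c.proj_smul g e
  rw [← ModuleCat.comp_apply, ← singularCohomology.map_comp, h]

/-- **The image of `p^*` is the deck-invariant classes** when `|G|` is invertible in `F`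
(Hatcher Prop. 3G.1: *"`H^k(X; F) → H^k(X̃; F)` is injective with image the `G`-invariants"*; an
invariant `y` equals `p^*(|G|⁻¹ τ^* y)` since `p^* τ^* = Σ_g g^*`). [cite: HatcherAT2002, §3.G Prop. 3G.1] -/
theorem mem_range_map_proj_iff (hG : (Fintype.card G : F) ≠ 0) (k : ℕ) (y : singularCohomology F F E k) :
    y ∈ Set.range (singularCohomology.map F F c.proj k) ↔
      ∀ g : G, singularCohomology.map F F (c.deck g) k y = y := by
  constructor
  · rintro ⟨x, rfl⟩ g
    exact c.cohomologyMap_deck_map_proj F g k x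
  · intro hy
    refine ⟨(Fintype.card G : F)⁻¹ • c.transferMap k y, ?_⟩
    rw [map_smul, c.map_proj_transferMap, Finset.sum_congr rfl fun g _ => hy g, Finset.sum_const,
      Finset.card_univ, ← Nat.cast_smul_eq_nsmul F, smul_smul, inv_mul_cancel₀ hG, one_smul]

/-- The deck group's action on `H^k(E; F)` as a representation, `g ↦ (g⁻¹)^*`. [folklore] -/
def cohomologyRep (k : ℕ) : Representation F G (singularCohomology F F E k) where
  toFun g := (singularCohomology.map F F (c.deck g⁻¹) k).hom
  map_one' := by
    rw [inv_one, c.deck_one, singularCohomology.map_id]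
    rfl
  map_mul' g h := by
    rw [mul_inv_rev, c.deck_mul, singularCohomology.map_comp, ModuleCat.hom_comp]
    rfl

/-- Values of `cohomologyRep`. [folklore] -/
lemma cohomologyRep_apply (k : ℕ) (g : G) (y : singularCohomology F F E k) :
    c.cohomologyRep F k g y = singularCohomology.map F F (c.deck g⁻¹) k y := rfl

/-- **`|G| · dim H^k(B; F) = Σ_{g ∈ G} tr(g^* | H^k(E; F))`** for a finite regular covering
`E → B` and a field `F` in which `|G|` is invertible: `H^k(B; F) ≅ H^k(E; F)^G` by the transfer
(Hatcher Prop. 3G.1) and the dimension of the invariants is the average of the traces (Serre §2.3).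
[cite: HatcherAT2002, §3.G Prop. 3G.1] [cite: SerreLinearRepresentations1977, §2.3 (projection onto invariants)] -/
theorem card_mul_finrank_eq_sum_trace (hG : (Fintype.card G : F) ≠ 0) (k : ℕ)
    [Module.Finite F (singularCohomology F F E k)] :
    (Fintype.card G : F) * Module.finrank F (singularCohomology F F B k) =
      ∑ g : G, LinearMap.trace F _ (singularCohomology.map F F (c.deck g) k).hom := by
  haveI : Invertible (Nat.card G : F) := invertibleOfNonzero (by rwa [Nat.card_eq_fintype_card])
  have h := (c.cohomologyRep F k).card_inv_mul_sum_char_eq_finrank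
  -- the invariants are the image of the injective `p^*`
  have hinv : (c.cohomologyRep F k).invariants =
      LinearMap.range (singularCohomology.map F F c.proj k).hom := by
    ext y
    rw [Representation.mem_invariants, LinearMap.mem_range]
    change (∀ g : G, singularCohomology.map F F (c.deck g⁻¹) k y = y) ↔
      y ∈ Set.range (singularCohomology.map F F c.proj k)
    rw [c.mem_range_map_proj_iff F hG k y]
    constructor
    · intro h g; simpa using h g⁻¹
    · intro h g; exact h g⁻¹
  rw [hinv, LinearMap.finrank_range_of_inj (c.map_proj_injective_of_card_ne_zero F hG k)] at h
  rw [← h, Nat.card_eq_fintype_card, ← mul_assoc, mul_inv_cancel₀ hG, one_mul]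
  refine Fintype.sum_equiv (Equiv.inv G) _ _ fun g => ?_
  rfl

end FiniteDeckCover

/-! ### §3 Closed manifolds: finiteness, vanishing and field-independence of the Euler characteristic -/

section ClosedManifold

variable (F : Type v) [Field F] (n : ℕ) (M : Type u) [TopologicalSpace M] [T2Space M] [CompactSpace M]
  [ChartedSpace (EuclideanSpace ℝ (Fin n)) M]

include n in
/-- **`H^k(M; F)` is finite-dimensional for a closed manifold** and any field `F` (Hatcher Cor. A.8–A.9
for the homology, the tree's `finite_singularHomology_of_compactSpace_holds`, and the universal
coefficient isomorphism `H^k ≅ Hom(H_k, F)`, `kroneckerPairing_bijective_of_field`).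
[cite: HatcherAT2002, App. A Cor. A.8–A.9 and §3.1 Thm. 3.2] -/
theorem finite_singularCohomology_of_closedManifold (k : ℕ) :
    Module.Finite F (singularCohomology F F M k) := by
  haveI : Module.Finite F (singularHomology F F M k) :=
    finite_singularHomology_of_compactSpace_holds (R := F) M n k
  exact Module.Finite.equiv (LinearEquiv.ofBijective _ (kroneckerPairing_bijective_of_field F M k)).symm

/-- **`H^k(M; F) = 0` for `k > n`** on a closed `n`-manifold and any field `F` (Hatcher Thm. 3.26(c),
the tree's `isZero_singularHomology_of_lt_holds`, dualised by `kroneckerPairing_bijective_of_field`).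
[cite: HatcherAT2002, §3.3 Thm. 3.26 (c) and §3.1 Thm. 3.2] -/
theorem subsingleton_singularCohomology_of_lt {k : ℕ} (hk : n < k) :
    Subsingleton (singularCohomology F F M k) := by
  haveI : Subsingleton (singularHomology F F M k) :=
    ModuleCat.subsingleton_of_isZero (isZero_singularHomology_of_lt_holds (R := F) (M := F) (X := M) n hk)
  haveI : Subsingleton (singularHomology F F M k →ₗ[F] F) := inferInstance
  exact (kroneckerPairing_bijective_of_field F M k).1.subsingleton

/-- **The Euler characteristic of a closed manifold is the same over `ℂ` and over `𝔽ₚ`**: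
`Σ_{k≤n} (-1)^k dim_ℂ H^k(M; ℂ) = Σ_{k≤n} (-1)^k dim_{𝔽ₚ} H^k(M; 𝔽ₚ)`, both being
`Σ (-1)^k rank H_k(M; ℤ)` (Hatcher §3.A Exercise 1 with Cor. 3A.6; the tree's
`eulerChar_int_eq_eulerChar_zmod`, `bettiNumber_int_eq_rat`, `bettiNumber_eq_of_algebra` and
`finrank_singularCohomology_eq_bettiNumber_of_field`). [cite: HatcherAT2002, §3.A Exercise 1 (p. 268) and Cor. 3A.6] -/
theorem euler_complex_eq_euler_zmod (p : ℕ) [Fact p.Prime] :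
    ∑ k ∈ Finset.range (n + 1), (-1 : ℤ) ^ k * (Module.finrank ℂ (singularCohomology ℂ ℂ M k) : ℤ) =
      ∑ k ∈ Finset.range (n + 1), (-1 : ℤ) ^ k *
        (Module.finrank (ZMod p) (singularCohomology (ZMod p) (ZMod p) M k) : ℤ) := by
  have hC : ∀ k, Module.finrank ℂ (singularCohomology ℂ ℂ M k) = Module.finrank ℤ (singularHomology ℤ ℤ M k) := by
    intro k
    rw [finrank_singularCohomology_eq_bettiNumber_of_field, ← bettiNumber_eq_of_algebra ℚ ℂ M k,
      ← bettiNumber_int_eq_rat]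
    rfl
  have hP : ∀ k, Module.finrank (ZMod p) (singularCohomology (ZMod p) (ZMod p) M k) =
      Module.finrank (ZMod p) (singularHomology (ZMod p) (ZMod p) M k) := fun k =>
    finrank_singularCohomology_eq_bettiNumber_of_field (ZMod p) M k
  simp only [hC, hP]
  exact eulerChar_int_eq_eulerChar_zmod (p := p) n M

end ClosedManifold

/-! ### §4 The orbit space of a free homeomorphism of prime order -/

section LocalHomeomorphCharts

variable {X : Type u} {Y : Type w} [TopologicalSpace X] [TopologicalSpace Y] {f : X → Y}

/-- **Charts from a surjective local homeomorphism**: the local inverses of `f : X → Y` form an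
atlas on `Y` modelled on `X` (so that a space covered by a manifold is a manifold, Hatcher 2002,
§1.3, p. 70: a covering space projection is a local homeomorphism). [cite: HatcherAT2002, §1.3 (p. 70, covering spaces of manifolds)] -/
@[reducible]
def chartedSpaceOfIsLocalHomeomorph (hf : IsLocalHomeomorph f) (hsurj : Function.Surjective f) :
    ChartedSpace X Y where
  atlas := Set.range fun x : X => hf.localInverseAt x
  chartAt y := hf.localInverseAt (Classical.choose (hsurj y))
  mem_chart_source y := by
    have h : f (Classical.choose (hsurj y)) ∈ (hf.localInverseAt (Classical.choose (hsurj y))).source :=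
      hf.apply_self_mem_localInverseAt_source
    rwa [Classical.choose_spec (hsurj y)] at h
  chart_mem_atlas y := ⟨_, rfl⟩

end LocalHomeomorphCharts

section OrbitSpaceDefs

variable {M : Type u} [TopologicalSpace M]

/-- The orbit relation of the cyclic group `⟨t⟩` generated by a homeomorphism: `x ∼ y` iff
`tⁱ x = y` for some `i ∈ ℤ`. [cite: HatcherAT2002, §1.3 (p. 72, orbit space of a group action)] -/
def orbitSetoid (t : M ≃ₜ M) : Setoid M where
  r x y := ∃ i : ℤ, (t ^ i) x = y
  iseqv :=
    ⟨fun x => ⟨0, by rw [zpow_zero, Homeomorph.one_apply]⟩,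
      fun {x y} h => by
        obtain ⟨i, h⟩ := h
        refine ⟨-i, ?_⟩
        rw [← h, ← Homeomorph.mul_apply, ← zpow_add, neg_add_cancel, zpow_zero, Homeomorph.one_apply],
      fun {x y z} h h' => by
        obtain ⟨i, h⟩ := h
        obtain ⟨j, h'⟩ := h'
        exact ⟨j + i, by rw [zpow_add, Homeomorph.mul_apply, h, h']⟩⟩

/-- **The orbit space `M/⟨t⟩`** of the cyclic group generated by a homeomorphism `t`.
[cite: HatcherAT2002, §1.3 (p. 72, orbit space of a group action)] -/
abbrev OrbitSpace (t : M ≃ₜ M) : Type u := Quotient (orbitSetoid t)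

namespace OrbitSpace

variable (t : M ≃ₜ M)

/-- The projection `M → M/⟨t⟩`. [cite: HatcherAT2002, §1.3 (p. 72)] -/
def proj : C(M, OrbitSpace t) := ⟨Quotient.mk (orbitSetoid t), continuous_quot_mk⟩

/-- `proj` is the quotient map. [folklore] -/
lemma proj_apply (x : M) : proj t x = Quotient.mk (orbitSetoid t) x := rfl

/-- `proj` is onto. [folklore] -/
lemma proj_surjective : Function.Surjective (proj t) := Quotient.mk_surjective

/-- `proj x = proj y` iff `tⁱ x = y` for some `i ∈ ℤ`. [cite: HatcherAT2002, §1.3 (p. 72)] -/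
lemma proj_eq_iff {x y : M} : proj t x = proj t y ↔ ∃ i : ℤ, (t ^ i) x = y := Quotient.eq

/-- `proj (tⁱ x) = proj x`. [folklore] -/
lemma proj_zpow_apply (i : ℤ) (x : M) : proj t ((t ^ i) x) = proj t x :=
  (proj_eq_iff t).2 ⟨-i, by rw [← Homeomorph.mul_apply, ← zpow_add, neg_add_cancel, zpow_zero,
    Homeomorph.one_apply]⟩

/-- `proj (tⁱ x) = proj x` (`i ∈ ℕ`). [folklore] -/
lemma proj_pow_apply (i : ℕ) (x : M) : proj t ((t ^ i) x) = proj t x := by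
  rw [← zpow_natCast]; exact proj_zpow_apply t i x

/-- `proj (t x) = proj x`. [folklore] -/
lemma proj_apply_self (x : M) : proj t (t x) = proj t x := by
  simpa only [pow_one] using proj_pow_apply t 1 x

/-- The homeomorphism group acts on the space (`f • x = f x`); a local instance. [folklore] -/
@[reducible]
def homeoMulAction : MulAction (M ≃ₜ M) M where
  smul f x := f x
  one_smul _ := rfl
  mul_smul _ _ _ := rfl

attribute [local instance] homeoMulAction

/-- `g • x = g x` for `g ∈ ⟨t⟩`. [folklore] -/
lemma zpowers_smul_def (g : Subgroup.zpowers t) (x : M) : g • x = (g : M ≃ₜ M) x := rfl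

variable {p : ℕ} [hp : Fact p.Prime]

/-- `t` has finite order when `t^p = 1`. [folklore] -/
lemma isOfFinOrder_of_pow_eq_one (ht : t ^ p = 1) : IsOfFinOrder t :=
  isOfFinOrder_iff_pow_eq_one.2 ⟨p, hp.out.pos, ht⟩

/-- **A free homeomorphism of prime period has order exactly `p`** (on a non-empty space).
[cite: HatcherAT2002, §1.3 Prop. 1.40] -/
lemma orderOf_eq [Nonempty M] (ht : t ^ p = 1) (hfree : ∀ i : ℕ, 0 < i → i < p → ∀ x : M, (t ^ i) x ≠ x) :
    orderOf t = p := by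
  refine orderOf_eq_prime ht fun h1 => ?_
  obtain ⟨x⟩ := ‹Nonempty M›
  exact hfree 1 one_pos hp.out.one_lt x (by rw [pow_one, h1, Homeomorph.one_apply])

/-- Every element of `⟨t⟩` is `tⁱ` with `0 ≤ i < p` when `t^p = 1`. [folklore] -/
lemma exists_coe_eq_pow (ht : t ^ p = 1) (g : Subgroup.zpowers t) : ∃ i : ℕ, i < p ∧ (g : M ≃ₜ M) = t ^ i := by
  obtain ⟨k, hk⟩ := Subgroup.mem_zpowers_iff.1 g.2
  have hp0 : (0 : ℤ) < p := by exact_mod_cast hp.out.pos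
  refine ⟨(k % p).toNat, ?_, ?_⟩
  · have := Int.emod_lt_of_pos k hp0
    omega
  · rw [← hk, zpow_eq_zpow_emod' k ht, ← zpow_natCast, Int.toNat_of_nonneg (Int.emod_nonneg _ hp0.ne')]

/-- `proj x = proj y` iff `tⁱ x = y` for some `0 ≤ i < p`, when `t^p = 1`. [folklore] -/
lemma proj_eq_iff_exists_lt (ht : t ^ p = 1) {x y : M} :
    proj t x = proj t y ↔ ∃ i : ℕ, i < p ∧ (t ^ i) x = y := by
  rw [proj_eq_iff]
  have hp0 : (0 : ℤ) < p := by exact_mod_cast hp.out.pos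
  constructor
  · rintro ⟨k, hk⟩
    refine ⟨(k % p).toNat, ?_, ?_⟩
    · have := Int.emod_lt_of_pos k hp0
      omega
    · rw [← hk, zpow_eq_zpow_emod' k ht, ← zpow_natCast, Int.toNat_of_nonneg (Int.emod_nonneg _ hp0.ne')]
  · rintro ⟨i, -, hi⟩
    exact ⟨i, by rw [zpow_natCast, hi]⟩

/-- **The cyclic group of a free homeomorphism of prime period acts freely.** [cite: HatcherAT2002, §1.3 Prop. 1.40] -/
lemma eq_one_of_smul_eq (ht : t ^ p = 1) (hfree : ∀ i : ℕ, 0 < i → i < p → ∀ x : M, (t ^ i) x ≠ x)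
    (g : Subgroup.zpowers t) (x : M) (h : g • x = x) : g = 1 := by
  obtain ⟨i, hi, hg⟩ := exists_coe_eq_pow t ht g
  rcases Nat.eq_zero_or_pos i with rfl | hipos
  · exact Subtype.ext (by rw [hg, pow_zero]; rfl)
  · exact absurd (by rw [zpowers_smul_def, hg] at h; exact h) (hfree i hipos hi x)

/-- `⟨t⟩` is finite when `t^p = 1`: `|⟨t⟩| = ord t`. [folklore] -/
@[reducible]
def zpowersFintype (ht : t ^ p = 1) : Fintype (Subgroup.zpowers t) :=
  Fintype.ofEquiv (Fin (orderOf t)) (finEquivZPowers (isOfFinOrder_of_pow_eq_one t ht))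

/-- `|⟨t⟩| = p` for a free homeomorphism of prime period. [cite: HatcherAT2002, §1.3 Prop. 1.40] -/
lemma card_zpowers [Nonempty M] (ht : t ^ p = 1) (hfree : ∀ i : ℕ, 0 < i → i < p → ∀ x : M, (t ^ i) x ≠ x) :
    @Fintype.card _ (zpowersFintype t ht) = p := by
  rw [zpowersFintype, Fintype.ofEquiv_card, Fintype.card_fin, orderOf_eq t ht hfree]

/-- `proj e₁ = proj e₂` iff `e₁` lies in the `⟨t⟩`-orbit of `e₂`. [folklore] -/
lemma proj_eq_iff_mem_orbit {e₁ e₂ : M} : proj t e₁ = proj t e₂ ↔ e₁ ∈ MulAction.orbit (Subgroup.zpowers t) e₂ := by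
  rw [proj_eq_iff, MulAction.mem_orbit_iff]
  constructor
  · rintro ⟨i, h⟩
    refine ⟨⟨t ^ (-i), Subgroup.zpow_mem_zpowers t (-i)⟩, ?_⟩
    rw [zpowers_smul_def, ← h, ← Homeomorph.mul_apply, ← zpow_add, neg_add_cancel, zpow_zero,
      Homeomorph.one_apply]
  · rintro ⟨g, h⟩
    obtain ⟨k, hk⟩ := Subgroup.mem_zpowers_iff.1 g.2
    refine ⟨-k, ?_⟩
    rw [← h, zpowers_smul_def, ← hk, ← Homeomorph.mul_apply, ← zpow_add, neg_add_cancel, zpow_zero,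
      Homeomorph.one_apply]

/-- **`M → M/⟨t⟩` is a covering map** for a free homeomorphism `t` of prime period of a locally
compact Hausdorff space (Hatcher Prop. 1.40: the orbit map of a free action of a finite group on a
Hausdorff space is a normal covering; Mathlib's `isQuotientCoveringMap_of_properlyDiscontinuousSMul`).
[cite: HatcherAT2002, §1.3 Prop. 1.40] -/
theorem isCoveringMap_proj [T2Space M] [LocallyCompactSpace M] (ht : t ^ p = 1)
    (hfree : ∀ i : ℕ, 0 < i → i < p → ∀ x : M, (t ^ i) x ≠ x) : IsCoveringMap (proj t) := by
  letI := zpowersFintype t ht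
  haveI : ContinuousConstSMul (Subgroup.zpowers t) M := ⟨fun g => (g : M ≃ₜ M).continuous⟩
  haveI : IsCancelSMul (Subgroup.zpowers t) M :=
    isCancelSMul_iff_eq_one_of_smul_eq.2 (eq_one_of_smul_eq t ht hfree)
  have hq : Topology.IsQuotientMap (proj t) := isQuotientMap_quot_mk
  exact (hq.isQuotientCoveringMap_of_properlyDiscontinuousSMul (G := Subgroup.zpowers t)
    (fun {e₁ e₂} => proj_eq_iff_mem_orbit t)).isCoveringMap

/-- **`M → M/⟨t⟩` as a finite regular covering** with deck group `⟨t⟩` (for the transfer and the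
Smith sequences). [cite: HatcherAT2002, §1.3 Prop. 1.40] -/
def deckCover [T2Space M] [LocallyCompactSpace M] (ht : t ^ p = 1)
    (hfree : ∀ i : ℕ, 0 < i → i < p → ∀ x : M, (t ^ i) x ≠ x) :
    letI := zpowersFintype t ht
    FiniteDeckCover (Subgroup.zpowers t) M (OrbitSpace t) :=
  letI := zpowersFintype t ht
  { proj := proj t
    isCoveringMap_proj := isCoveringMap_proj t ht hfree
    surjective_proj := proj_surjective t
    continuous_smul := fun g => (g : M ≃ₜ M).continuous
    proj_smul := fun g e => by
      obtain ⟨k, hk⟩ := Subgroup.mem_zpowers_iff.1 g.2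
      rw [zpowers_smul_def, ← hk]
      exact proj_zpow_apply t k e
    exists_smul_of_proj_eq := fun {e e'} h => by
      obtain ⟨g, hg⟩ := (proj_eq_iff_mem_orbit t).1 h
      exact ⟨g, hg.symm⟩ }

/-- The deck transformation of `g = tⁱ ∈ ⟨t⟩` is `tⁱ`. [folklore] -/
lemma deckCover_deck [T2Space M] [LocallyCompactSpace M] (ht : t ^ p = 1)
    (hfree : ∀ i : ℕ, 0 < i → i < p → ∀ x : M, (t ^ i) x ≠ x) (g : Subgroup.zpowers t) :
    (@FiniteDeckCover.deck _ _ (zpowersFintype t ht) _ _ _ _ _ (deckCover t ht hfree) g) =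
      ((g : M ≃ₜ M) : C(M, M)) := rfl

/-- **`M/⟨t⟩` is a topological manifold** modelled on the same space as `M` (charts: local inverses
of the covering projection followed by charts of `M`). [cite: HatcherAT2002, §1.3 (p. 70)] -/
@[reducible]
def chartedSpace {H : Type*} [TopologicalSpace H] [ChartedSpace H M] [T2Space M] [LocallyCompactSpace M]
    (ht : t ^ p = 1) (hfree : ∀ i : ℕ, 0 < i → i < p → ∀ x : M, (t ^ i) x ≠ x) :
    ChartedSpace H (OrbitSpace t) :=
  letI := chartedSpaceOfIsLocalHomeomorph (isCoveringMap_proj t ht hfree).isLocalHomeomorph (proj_surjective t)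
  ChartedSpace.comp H M (OrbitSpace t)

/-- **`M/⟨t⟩` is Hausdorff** (quotient of a locally compact Hausdorff space by a finite group).
[cite: HatcherAT2002, §1.3 Prop. 1.40] -/
theorem t2Space [T2Space M] [LocallyCompactSpace M] (ht : t ^ p = 1) : T2Space (OrbitSpace t) := by
  letI := zpowersFintype t ht
  haveI : ContinuousConstSMul (Subgroup.zpowers t) M := ⟨fun g => (g : M ≃ₜ M).continuous⟩
  have hset : orbitSetoid t = MulAction.orbitRel (Subgroup.zpowers t) M := by
    refine Setoid.ext fun x y => ?_
    change (∃ i : ℤ, (t ^ i) x = y) ↔ x ∈ MulAction.orbit (Subgroup.zpowers t) y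
    rw [← proj_eq_iff_mem_orbit, proj_eq_iff]
  change T2Space (Quotient (orbitSetoid t))
  rw [hset]
  infer_instance

section Transfer

variable [T2Space M] [LocallyCompactSpace M]

/-- **`q^* : H^k(M/⟨t⟩; ℂ) → H^k(M; ℂ)` is injective** (`q` the orbit map; transfer, Hatcher Prop. 3G.1).
[cite: HatcherAT2002, §3.G Prop. 3G.1] -/
theorem map_proj_injective [Nonempty M] (ht : t ^ p = 1)
    (hfree : ∀ i : ℕ, 0 < i → i < p → ∀ x : M, (t ^ i) x ≠ x) (k : ℕ) :
    Function.Injective (singularCohomology.map ℂ ℂ (proj t) k) := by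
  letI := zpowersFintype t ht
  have hG : (Fintype.card (Subgroup.zpowers t) : ℂ) ≠ 0 := by
    rw [card_zpowers t ht hfree]; exact_mod_cast hp.out.ne_zero
  exact (deckCover t ht hfree).map_proj_injective_of_card_ne_zero ℂ hG k

/-- **The image of `q^*` is the `t^*`-fixed classes**: `y ∈ q^* H^k(M/⟨t⟩; ℂ)` iff `t^* y = y`
(Hatcher Prop. 3G.1; invariance under the generator is invariance under `⟨t⟩`).
[cite: HatcherAT2002, §3.G Prop. 3G.1] -/
theorem mem_range_map_proj_iff [Nonempty M] (ht : t ^ p = 1)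
    (hfree : ∀ i : ℕ, 0 < i → i < p → ∀ x : M, (t ^ i) x ≠ x) (k : ℕ) (y : singularCohomology ℂ ℂ M k) :
    y ∈ Set.range (singularCohomology.map ℂ ℂ (proj t) k) ↔
      singularCohomology.map ℂ ℂ (t : C(M, M)) k y = y := by
  letI := zpowersFintype t ht
  have hG : (Fintype.card (Subgroup.zpowers t) : ℂ) ≠ 0 := by
    rw [card_zpowers t ht hfree]; exact_mod_cast hp.out.ne_zero
  have h1 := (deckCover t ht hfree).mem_range_map_proj_iff ℂ hG k y
  change (y ∈ Set.range (singularCohomology.map ℂ ℂ (proj t) k) ↔ _) at h1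
  rw [h1]
  constructor
  · intro h
    exact h ⟨t, Subgroup.mem_zpowers t⟩
  · intro h g
    obtain ⟨i, -, hg⟩ := exists_coe_eq_pow t ht g
    rw [deckCover_deck, hg]
    clear hg
    induction i with
    | zero =>
      have hcoe : ((t ^ 0 : M ≃ₜ M) : C(M, M)) = ContinuousMap.id M := by
        ext x; rw [pow_zero]; rfl
      rw [hcoe, singularCohomology.map_id]; rfl
    | succ i ih =>
      have hcoe : ((t ^ (i + 1) : M ≃ₜ M) : C(M, M)) = ((t ^ i : M ≃ₜ M) : C(M, M)).comp (t : C(M, M)) := by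
        ext x; rw [pow_succ]; rfl
      rw [hcoe, singularCohomology.map_comp, ModuleCat.comp_apply, ih, h]

/-- **`dim H^k(M/⟨t⟩; ℂ) = dim ker(t^* - 1 | H^k(M; ℂ))`**: the orbit map identifies the cohomology of
the orbit space with the `t`-invariant classes (Hatcher Prop. 3G.1). [cite: HatcherAT2002, §3.G Prop. 3G.1] -/
theorem finrank_cohomology_orbitSpace_eq [Nonempty M] (ht : t ^ p = 1)
    (hfree : ∀ i : ℕ, 0 < i → i < p → ∀ x : M, (t ^ i) x ≠ x) (k : ℕ) :
    Module.finrank ℂ (singularCohomology ℂ ℂ (OrbitSpace t) k) =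
      Module.finrank ℂ (LinearMap.ker ((singularCohomology.map ℂ ℂ (t : C(M, M)) k).hom - 1)) := by
  have hinj := map_proj_injective t ht hfree k
  rw [← LinearMap.finrank_range_of_inj (f := (singularCohomology.map ℂ ℂ (proj t) k).hom) hinj]
  have hrange : LinearMap.range (singularCohomology.map ℂ ℂ (proj t) k).hom =
      LinearMap.ker ((singularCohomology.map ℂ ℂ (t : C(M, M)) k).hom - 1) := by
    ext y
    rw [LinearMap.mem_ker, LinearMap.sub_apply, Module.End.one_apply, sub_eq_zero, LinearMap.mem_range]
    exact mem_range_map_proj_iff t ht hfree k y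
  rw [hrange]

end Transfer

section Induced

variable {t}

/-- **The homeomorphism of `M/⟨t⟩` induced by a homeomorphism `s` of `M` commuting with `t`.**
[cite: Bredon1993, Ch. IV §20 (p. 240, "natural with respect to equivariant maps")] -/
def map (s : M ≃ₜ M) (hs : Commute s t) : OrbitSpace t ≃ₜ OrbitSpace t where
  toFun := Quotient.map' s fun x y hxy => by
    obtain ⟨i, h⟩ := hxy
    refine ⟨i, ?_⟩
    rw [← h, ← Homeomorph.mul_apply, ← (hs.zpow_right i).eq, Homeomorph.mul_apply]
  invFun := Quotient.map' s.symm fun x y hxy => by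
    obtain ⟨i, h⟩ := hxy
    refine ⟨i, ?_⟩
    have hs' : Commute s⁻¹ t := hs.inv_left
    change (t ^ i) (s⁻¹ x) = s⁻¹ y
    rw [← h, ← Homeomorph.mul_apply, ← (hs'.zpow_right i).eq, Homeomorph.mul_apply]
  left_inv := by
    refine Quotient.ind fun x => ?_
    change Quotient.mk (orbitSetoid t) (s.symm (s x)) = Quotient.mk (orbitSetoid t) x
    rw [s.symm_apply_apply]
  right_inv := by
    refine Quotient.ind fun x => ?_
    change Quotient.mk (orbitSetoid t) (s (s.symm x)) = Quotient.mk (orbitSetoid t) x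
    rw [s.apply_symm_apply]
  continuous_toFun := s.continuous.quotient_map' _
  continuous_invFun := s.symm.continuous.quotient_map' _

/-- `map s (proj x) = proj (s x)`. [folklore] -/
@[simp] lemma map_proj (s : M ≃ₜ M) (hs : Commute s t) (x : M) : map s hs (proj t x) = proj t (s x) := rfl

/-- `map s ∘ proj = proj ∘ s` as continuous maps. [folklore] -/
lemma map_comp_proj (s : M ≃ₜ M) (hs : Commute s t) :
    ((map s hs : OrbitSpace t ≃ₜ OrbitSpace t) : C(OrbitSpace t, OrbitSpace t)).comp (proj t) =
      (proj t).comp (s : C(M, M)) := rfl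

/-- `(map s)ᵐ (proj x) = proj (sᵐ x)`. [folklore] -/
lemma map_pow_proj (s : M ≃ₜ M) (hs : Commute s t) (m : ℕ) (x : M) :
    ((map s hs) ^ m) (proj t x) = proj t ((s ^ m) x) := by
  induction m generalizing x with
  | zero => rw [pow_zero, pow_zero, Homeomorph.one_apply, Homeomorph.one_apply]
  | succ m ih => rw [pow_succ, pow_succ, Homeomorph.mul_apply, Homeomorph.mul_apply, map_proj, ih]

/-- Fixed points of the induced map: `map s (proj x) = proj x` iff `tⁱ (s x) = x` for some
`0 ≤ i < p`. [folklore] -/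
lemma map_proj_eq_proj_iff (ht : t ^ p = 1) (s : M ≃ₜ M) (hs : Commute s t) (x : M) :
    map s hs (proj t x) = proj t x ↔ ∃ i : ℕ, i < p ∧ (t ^ i) (s x) = x := by
  rw [map_proj, proj_eq_iff_exists_lt t ht]

end Induced

section Cohomology

variable [T2Space M] [CompactSpace M] {n : ℕ} [ChartedSpace (EuclideanSpace ℝ (Fin n)) M]

/-- **`χ_ℂ(M) = p · χ_ℂ(M/⟨t⟩)`** for a free homeomorphism `t` of prime period `p` of a closed
`n`-manifold: Floyd's formula / Bredon Ch. III Thm. 7.10 (free case, `𝔽ₚ` coefficients, PROVED in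
`FreeActionEulerCharacteristic`) read over `ℂ` through the field-independence of the Euler
characteristic of a closed manifold. [cite: Bredon1972, Ch. III Thm. 7.10]
[cite: AlldayPuppe1993, Rem. (3.10.19)(3), p. 207] -/
theorem euler_eq_prime_mul_euler [Nonempty M] (ht : t ^ p = 1)
    (hfree : ∀ i : ℕ, 0 < i → i < p → ∀ x : M, (t ^ i) x ≠ x) :
    ∑ k ∈ Finset.range (n + 1), (-1 : ℤ) ^ k * (Module.finrank ℂ (singularCohomology ℂ ℂ M k) : ℤ) =
      p * ∑ k ∈ Finset.range (n + 1), (-1 : ℤ) ^ k *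
        (Module.finrank ℂ (singularCohomology ℂ ℂ (OrbitSpace t) k) : ℤ) := by
  haveI := ChartedSpace.locallyCompactSpace (EuclideanSpace ℝ (Fin n)) M
  letI := zpowersFintype t ht
  letI : ChartedSpace (EuclideanSpace ℝ (Fin n)) (OrbitSpace t) := chartedSpace t ht hfree
  haveI : T2Space (OrbitSpace t) := t2Space t ht
  have hcard : Fintype.card (Subgroup.zpowers t) = p ^ 1 := by rw [pow_one]; exact card_zpowers t ht hfree
  obtain ⟨-, -, he⟩ := (deckCover t ht hfree).euler_eq_card_mul_euler_of_free (𝔽 := ZMod p) (p := p)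
    hcard (fun g e h => eq_one_of_smul_eq t ht hfree g e h) (N := n + 1)
    (finite_singularCohomology_of_closedManifold (ZMod p) n (OrbitSpace t))
    (fun k hk => subsingleton_singularCohomology_of_lt (ZMod p) n (OrbitSpace t) hk)
  rw [euler_complex_eq_euler_zmod n M p, euler_complex_eq_euler_zmod n (OrbitSpace t) p, he, pow_one]

end Cohomology

end OrbitSpace

end OrbitSpaceDefs

/-! ### §5 Lefschetz numbers of a free `ℤ/6`-action on a closed manifold -/

section ZModSix

variable {M : Type u} [TopologicalSpace M]

/-- `(aʲ)^* = (a^*)ʲ` on `H^k(M; ℂ)` for a homeomorphism `a`. [folklore] -/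
lemma singularCohomology_map_homeomorph_pow_hom (a : M ≃ₜ M) (j k : ℕ) :
    (singularCohomology.map ℂ ℂ ((a ^ j : M ≃ₜ M) : C(M, M)) k).hom =
      (singularCohomology.map ℂ ℂ (a : C(M, M)) k).hom ^ j := by
  induction j with
  | zero =>
    have hcoe : ((a ^ 0 : M ≃ₜ M) : C(M, M)) = ContinuousMap.id M := by
      ext x; rw [pow_zero]; rfl
    rw [hcoe, singularCohomology.map_id, pow_zero]
    rfl
  | succ j ih =>
    have hcoe : ((a ^ (j + 1) : M ≃ₜ M) : C(M, M)) = ((a ^ j : M ≃ₜ M) : C(M, M)).comp (a : C(M, M)) := by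
      ext x; rw [pow_succ]; rfl
    rw [hcoe, singularCohomology.map_comp, ModuleCat.hom_comp, ih, pow_succ', Module.End.mul_eq_comp]

/-- **Summing the averaging identity over degrees**: if `(B k)ᵐ = 1` and `d k = dim ker(B k - 1)` for
every `k`, then `m · Σ_{k<N} (-1)^k d k = Σ_{j<m} Σ_{k<N} (-1)^k tr((B k)ʲ)`. [folklore] -/
lemma mul_euler_eq_sum_traces {N m : ℕ} (V : ℕ → Type w) [∀ k, AddCommGroup (V k)] [∀ k, Module ℂ (V k)]
    [∀ k, FiniteDimensional ℂ (V k)] (B : ∀ k, Module.End ℂ (V k)) (hB : ∀ k, B k ^ m = 1)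
    (hm : (m : ℂ) ≠ 0) (d : ℕ → ℕ) (hd : ∀ k, d k = Module.finrank ℂ (LinearMap.ker (B k - 1))) :
    (m : ℂ) * ∑ k ∈ Finset.range N, (-1 : ℂ) ^ k * (d k : ℂ) =
      ∑ j ∈ Finset.range m, ∑ k ∈ Finset.range N, (-1 : ℂ) ^ k * LinearMap.trace ℂ (V k) (B k ^ j) := by
  rw [Finset.sum_comm, Finset.mul_sum]
  refine Finset.sum_congr rfl fun k _ => ?_
  rw [← Finset.mul_sum, ← card_mul_finrank_ker_eq_sum_trace_pow (B k) (hB k) hm, hd k]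
  ring

/-- The truncated complex Euler characteristic `Σ_{k<N} (-1)^k dim_ℂ H^k(X; ℂ)`. [folklore] -/
def eulerTrunc (N : ℕ) (X : Type u) [TopologicalSpace X] : ℤ :=
  ∑ k ∈ Finset.range N, (-1 : ℤ) ^ k * (Module.finrank ℂ (singularCohomology ℂ ℂ X k) : ℤ)

/-- `eulerTrunc` as a complex number. [folklore] -/
lemma cast_eulerTrunc (N : ℕ) (X : Type u) [TopologicalSpace X] :
    ((eulerTrunc N X : ℤ) : ℂ) =
      ∑ k ∈ Finset.range N, (-1 : ℂ) ^ k * (Module.finrank ℂ (singularCohomology ℂ ℂ X k) : ℂ) := by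
  unfold eulerTrunc; push_cast; rfl

/-- **The Lefschetz numbers of a free `ℤ/6`-action vanish in the mean over each cyclic subgroup.**
For a homeomorphism `a` of a closed topological `n`-manifold `M` with `a⁶ = 1` and `a²`, `a³` fixed-point
free (so `⟨a⟩ ≅ ℤ/6` acts freely), the Lefschetz numbers
`L(j) = Σ_{k ≤ n} (-1)^k tr((a^*)ʲ | H^k(M; ℂ))` satisfy **`L(3) = 0`, `L(2) + L(4) = 0`, `L(1) + L(5) = 0`**.
Classically each `L(j)` (`1 ≤ j ≤ 5`) vanishes by the Lefschetz fixed point theorem; here, without it: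
`Σ_{h ∈ H} L(h) = |H| · χ(M/H)` for `H = ⟨a³⟩, ⟨a²⟩, ⟨a⟩` by the transfer (Hatcher Prop. 3G.1,
`H^k(M/H; ℂ) = H^k(M; ℂ)^H`) and the averaging projector, while `χ(M) = 2χ(M/⟨a³⟩) = 3χ(M/⟨a²⟩)`,
`χ(M/⟨a³⟩) = 3χ(M/⟨a⟩)` by Smith theory (Floyd; Bredon 1972 Ch. III Thm. 7.10, free case), and
`L(0) = χ(M)`. [cite: Bredon1972, Ch. III Thm. 7.10]
[cite: HatcherAT2002, §3.G Prop. 3G.1] [cite: AlldayPuppe1993, Rem. (3.10.19)(3), p. 207] -/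
theorem lefschetz_sums_of_free_zmod_six {n : ℕ} [T2Space M] [CompactSpace M]
    [ChartedSpace (EuclideanSpace ℝ (Fin n)) M] [Nonempty M] (a : M ≃ₜ M) (ha : a ^ 6 = 1)
    (h2 : ∀ x : M, (a ^ 2) x ≠ x) (h3 : ∀ x : M, (a ^ 3) x ≠ x) :
    let L : ℕ → ℂ := fun j => ∑ k ∈ Finset.range (n + 1),
      (-1 : ℂ) ^ k * LinearMap.trace ℂ _ ((singularCohomology.map ℂ ℂ (a : C(M, M)) k).hom ^ j)
    L 3 = 0 ∧ L 2 + L 4 = 0 ∧ L 1 + L 5 = 0 := by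
  intro L
  haveI := ChartedSpace.locallyCompactSpace (EuclideanSpace ℝ (Fin n)) M
  haveI hfin : ∀ k, Module.Finite ℂ (singularCohomology ℂ ℂ M k) :=
    finite_singularCohomology_of_closedManifold ℂ n M
  haveI : Fact (Nat.Prime 2) := ⟨Nat.prime_two⟩
  haveI : Fact (Nat.Prime 3) := ⟨Nat.prime_three⟩
  -- the operators `A k = a^*|H^k` and `A⁶ = 1`
  let A : ∀ k : ℕ, Module.End ℂ (singularCohomology ℂ ℂ M k) :=
    fun k => (singularCohomology.map ℂ ℂ (a : C(M, M)) k).hom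
  have hApow : ∀ j k, (singularCohomology.map ℂ ℂ ((a ^ j : M ≃ₜ M) : C(M, M)) k).hom = A k ^ j :=
    fun j k => singularCohomology_map_homeomorph_pow_hom a j k
  have hA6 : ∀ k, A k ^ 6 = 1 := fun k => by
    rw [← hApow, ha]
    have hcoe : ((1 : M ≃ₜ M) : C(M, M)) = ContinuousMap.id M := rfl
    rw [hcoe, singularCohomology.map_id]
    rfl
  have hL : ∀ j, L j = ∑ k ∈ Finset.range (n + 1), (-1 : ℂ) ^ k * LinearMap.trace ℂ _ (A k ^ j) :=
    fun j => rfl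
  -- more fixed-point-freeness: `a`, `a⁴`, `a⁵`
  have h1 : ∀ x, a x ≠ x := fun x hx => h2 x (by rw [pow_two, Homeomorph.mul_apply, hx, hx])
  have h4 : ∀ x, (a ^ 4) x ≠ x := fun x hx => h2 x (by
    have : (a ^ 6) x = (a ^ 2) x := by
      rw [show (6 : ℕ) = 2 + 4 from rfl, pow_add, Homeomorph.mul_apply, hx]
    rw [ha, Homeomorph.one_apply] at this
    exact this.symm)
  have h5 : ∀ x, (a ^ 5) x ≠ x := fun x hx => h1 x (by
    have : (a ^ 6) x = a x := by
      rw [show (6 : ℕ) = 1 + 5 from rfl, pow_add, Homeomorph.mul_apply, hx, pow_one]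
    rw [ha, Homeomorph.one_apply] at this
    exact this.symm)
  -- Euler characteristics as integers (`e X = Σ (-1)^k dim H^k(X; ℂ)`), and `L 0 = χ(M)`
  have he := cast_eulerTrunc (n + 1)
  have hL0 : L 0 = (eulerTrunc (n + 1) M : ℂ) := by
    rw [he, hL]
    refine Finset.sum_congr rfl fun k _ => ?_
    rw [pow_zero, LinearMap.trace_one]
  ---------------------------------------------------------------- Step 1: `t = a³`, `p = 2`
  have ht3 : (a ^ 3) ^ 2 = 1 := by rw [← pow_mul]; exact ha
  have hfree3 : ∀ i : ℕ, 0 < i → i < 2 → ∀ x : M, ((a ^ 3) ^ i) x ≠ x := by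
    intro i hi0 hi2 x
    obtain rfl : i = 1 := by omega
    rw [pow_one]; exact h3 x
  have hE1 : (eulerTrunc (n + 1) M : ℂ) = 2 * (eulerTrunc (n + 1) (OrbitSpace (a ^ 3)) : ℂ) := by
    have h := OrbitSpace.euler_eq_prime_mul_euler (n := n) (a ^ 3) ht3 hfree3
    change eulerTrunc (n + 1) M = (2 : ℕ) * eulerTrunc (n + 1) (OrbitSpace (a ^ 3)) at h
    exact_mod_cast h
  have hS1 : (2 : ℂ) * (eulerTrunc (n + 1) (OrbitSpace (a ^ 3)) : ℂ) = L 0 + L 3 := by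
    rw [he]
    have h := mul_euler_eq_sum_traces (N := n + 1) (m := 2) (fun k => singularCohomology ℂ ℂ M k)
      (fun k => A k ^ 3) (fun k => by rw [← pow_mul]; exact hA6 k) two_ne_zero
      (fun k => Module.finrank ℂ (singularCohomology ℂ ℂ (OrbitSpace (a ^ 3)) k)) (fun k => by
        rw [OrbitSpace.finrank_cohomology_orbitSpace_eq (a ^ 3) ht3 hfree3 k, hApow])
    rw [Nat.cast_ofNat] at h
    rw [h, Finset.sum_range_succ, Finset.sum_range_one, hL, hL]
    simp only [pow_zero, pow_one]
  ---------------------------------------------------------------- Step 2: `t = a²`, `p = 3`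
  have ht2 : (a ^ 2) ^ 3 = 1 := by rw [← pow_mul]; exact ha
  have hfree2 : ∀ i : ℕ, 0 < i → i < 3 → ∀ x : M, ((a ^ 2) ^ i) x ≠ x := by
    intro i hi0 hi3 x
    interval_cases i
    · rw [pow_one]; exact h2 x
    · rw [← pow_mul]; exact h4 x
  have hE2 : (eulerTrunc (n + 1) M : ℂ) = 3 * (eulerTrunc (n + 1) (OrbitSpace (a ^ 2)) : ℂ) := by
    have h := OrbitSpace.euler_eq_prime_mul_euler (n := n) (a ^ 2) ht2 hfree2
    change eulerTrunc (n + 1) M = (3 : ℕ) * eulerTrunc (n + 1) (OrbitSpace (a ^ 2)) at h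
    exact_mod_cast h
  have hS2 : (3 : ℂ) * (eulerTrunc (n + 1) (OrbitSpace (a ^ 2)) : ℂ) = L 0 + L 2 + L 4 := by
    rw [he]
    have h := mul_euler_eq_sum_traces (N := n + 1) (m := 3) (fun k => singularCohomology ℂ ℂ M k)
      (fun k => A k ^ 2) (fun k => by rw [← pow_mul]; exact hA6 k) three_ne_zero
      (fun k => Module.finrank ℂ (singularCohomology ℂ ℂ (OrbitSpace (a ^ 2)) k)) (fun k => by
        rw [OrbitSpace.finrank_cohomology_orbitSpace_eq (a ^ 2) ht2 hfree2 k, hApow])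
    rw [Nat.cast_ofNat] at h
    rw [h, Finset.sum_range_succ, Finset.sum_range_succ, Finset.sum_range_one, hL, hL, hL]
    simp only [pow_zero, pow_one, ← pow_mul]
  ---------------------------------------------------------------- Step 3: `Y = M/⟨a³⟩`, `ā`, `p = 3`
  let Y := OrbitSpace (a ^ 3)
  letI : ChartedSpace (EuclideanSpace ℝ (Fin n)) Y := OrbitSpace.chartedSpace (a ^ 3) ht3 hfree3
  haveI : T2Space Y := OrbitSpace.t2Space (a ^ 3) ht3
  haveI : LocallyCompactSpace Y := ChartedSpace.locallyCompactSpace (EuclideanSpace ℝ (Fin n)) Y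
  haveI : Nonempty Y := ⟨OrbitSpace.proj (a ^ 3) (Classical.arbitrary M)⟩
  have hcomm : Commute a (a ^ 3) := (Commute.refl a).pow_right 3
  let abar : Y ≃ₜ Y := OrbitSpace.map a hcomm
  have habar3 : abar ^ 3 = 1 := by
    refine Homeomorph.ext fun y => ?_
    obtain ⟨x, rfl⟩ := OrbitSpace.proj_surjective (a ^ 3) y
    rw [Homeomorph.one_apply]
    exact (OrbitSpace.map_pow_proj a hcomm 3 x).trans (OrbitSpace.proj_apply_self (a ^ 3) x)
  have hfreebar : ∀ i : ℕ, 0 < i → i < 3 → ∀ y : Y, (abar ^ i) y ≠ y := by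
    intro i hi0 hi3 y hy
    obtain ⟨x, rfl⟩ := OrbitSpace.proj_surjective (a ^ 3) y
    rw [OrbitSpace.map_pow_proj a hcomm i x, OrbitSpace.proj_eq_iff_exists_lt (a ^ 3) ht3] at hy
    obtain ⟨j, hj, hjx⟩ := hy
    interval_cases i
    · interval_cases j
      · rw [pow_zero, Homeomorph.one_apply, pow_one] at hjx; exact h1 x hjx
      · rw [pow_one, pow_one, ← Homeomorph.mul_apply, ← pow_succ] at hjx; exact h4 x hjx
    · interval_cases j
      · rw [pow_zero, Homeomorph.one_apply] at hjx; exact h2 x hjx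
      · rw [pow_one, ← Homeomorph.mul_apply, ← pow_add] at hjx; exact h5 x hjx
  have hE3 : (eulerTrunc (n + 1) Y : ℂ) = 3 * (eulerTrunc (n + 1) (OrbitSpace abar) : ℂ) := by
    have h := OrbitSpace.euler_eq_prime_mul_euler (n := n) abar habar3 hfreebar
    change eulerTrunc (n + 1) Y = (3 : ℕ) * eulerTrunc (n + 1) (OrbitSpace abar) at h
    exact_mod_cast h
  have hS3 : (6 : ℂ) * (eulerTrunc (n + 1) (OrbitSpace abar) : ℂ) = L 0 + L 1 + L 2 + L 3 + L 4 + L 5 := by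
    rw [he]
    have h := mul_euler_eq_sum_traces (N := n + 1) (m := 6) (fun k => singularCohomology ℂ ℂ M k)
      A hA6 (by norm_num) (fun k => Module.finrank ℂ (singularCohomology ℂ ℂ (OrbitSpace abar) k))
      (fun k => by
        -- `dim H^k(Z) = dim ker(ā^* - 1) = dim ker(a^* - 1)`
        rw [OrbitSpace.finrank_cohomology_orbitSpace_eq abar habar3 hfreebar k]
        refine finrank_ker_sub_one_eq_of_comm (A k) _ (singularCohomology.map ℂ ℂ (OrbitSpace.proj (a ^ 3)) k).hom
          (OrbitSpace.map_proj_injective (a ^ 3) ht3 hfree3 k) ?_ ?_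
        · -- equivariance `a^* ∘ q^* = q^* ∘ ā^*`
          have hc := singularCohomology.map_comp ℂ ℂ (a : C(M, M)) (OrbitSpace.proj (a ^ 3)) k
          have hc' := singularCohomology.map_comp ℂ ℂ (OrbitSpace.proj (a ^ 3)) (abar : C(Y, Y)) k
          rw [OrbitSpace.map_comp_proj a hcomm] at hc'
          rw [hc'] at hc
          have := congrArg ModuleCat.Hom.hom hc
          rw [ModuleCat.hom_comp, ModuleCat.hom_comp] at this
          exact this.symm
        · intro v hv
          rw [LinearMap.mem_range]
          refine (OrbitSpace.mem_range_map_proj_iff (a ^ 3) ht3 hfree3 k v).2 ?_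
          change (singularCohomology.map ℂ ℂ ((a ^ 3 : M ≃ₜ M) : C(M, M)) k).hom v = v
          rw [hApow]
          change A k (A k (A k v)) = v
          rw [hv, hv, hv])
    rw [show ((6 : ℕ) : ℂ) = 6 by norm_num] at h
    rw [h]
    iterate 5 rw [Finset.sum_range_succ]
    rw [Finset.sum_range_one]
  ---------------------------------------------------------------- arithmetic
  have hS1' := hS1; rw [← hE1, ← hL0] at hS1'
  have hS2' := hS2; rw [← hE2, ← hL0] at hS2'
  have h6 : (6 : ℂ) * (eulerTrunc (n + 1) (OrbitSpace abar) : ℂ) = (eulerTrunc (n + 1) M : ℂ) := by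
    rw [hE1, hE3]; ring
  rw [h6, ← hL0] at hS3
  refine ⟨?_, ?_, ?_⟩
  · -- `L 3 = 2χ(M/⟨a³⟩) - L 0 = χ(M) - χ(M)`
    linear_combination -hS1'
  · linear_combination -hS2'
  · linear_combination -hS3 + hS1' + hS2'

end ZModSix

end Literature.AlgebraicTopology.SingularHomology

end
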